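import Literature.Analysis.FluidPDE.Tao2016AveragedNS.SplitCascadeRescaledEnergy
import Literature.Analysis.FluidPDE.TaoCascadeRescaledExit
import Mathlib.Analysis.SpecialFunctions.Log.Basic
import HarnessLib

/-!
# The split Prop. 6.5: closing the exits (Lemmas 6.9, 6.10, Cor. 6.11) — layer 3 of the §6.5–6.7 port

T. Tao, *Finite time blowup for an averaged three-dimensional Navier–Stokes equation*,
J. Amer. Math. Soc. 29 (2016), 601–674 (arXiv:1402.0290v3), §6.5, pp. 35–36. HONEST FRAMING:
statements about the SPLIT cascade model system (rescaled hypotheses `RescaledSplitHypotheses`);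
nothing here proves the split Prop. 6.5 and nothing here concerns the true Navier–Stokes equations.

Split counterpart of `TaoCascadeRescaledExit.lean`, same lemma names under
`RescaledSplitHypotheses`. What changes relative to Tao's file, and ONLY this: every energy flux
reads `K Λ_k ((d̃²_{k-1} - Z̃²_{d,k-1}) ã_k - Λ (d̃²_k - Z̃²_{d,k}) ã_{k+1})`; wherever Tao's proof bounds a
factor `d_j²` by an ENERGY (`2Ẽ_j`, all interfaces except `1 → 2`), the split factor
`|d̃_j² - Z̃²_{d,j}| ≤ 2Ẽ_j` obeys the same bound (`abs_sq_sub_sqW_le_two_mul_energy`); at the one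
interface `1 → 2`, where Tao uses the bootstrap bound `|d₁| ≤ ½K⁻¹⁰` (not an energy bound), the
asymmetry `Z̃_{d,1}` of the fresh shell enters and a pointwise bound `|Z̃_{d,1}| ≤ ζ` on the window
with `ζ² ≤ ¼K⁻²⁰` is taken as a hypothesis (`exit_near`, `exit_far2`, `exit_trichotomy`) — in the
assembly it is supplied by the channel lemmas of `SplitCascadeRescaledChannels.lean` from the profile
clause at the checkpoint (it is `n₀`-small there). Lemma 6.9 is stated with the combined primary sum
`½(Σã² + ΣZ̃²)`. The `h`-free lemmas and constants (`rpow_neg_le_one_sub`, `primaryDefect`,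
`integral_le_hundred_mul`, `abs_sq_mul_le`, `hundred_le_of_regime`, `rpow3_le_one`, …) are Tao's own
(`TaoCascade.*`), reused.

## References

* T. Tao, J. Amer. Math. Soc. 29 (2016), 601–674, §6.5 Lemmas 6.9, 6.10, Cor. 6.11.
  [`Tao2016AveragedNS`]
-/

noncomputable section

open Set MeasureTheory intervalIntegral Filter Topology
open scoped Interval
open Literature.Analysis.ODE

namespace Literature.Analysis.FluidPDE

namespace Tao2016AveragedNS

open TaoCascade

/-! ## Lemma 6.9 and the exits, split version -/

section Exit

variable {γ ε₀ K ε C₁ C₂ C₃ : ℝ} {n₀ N : ℤ} {ηp : ℤ → ℝ} {βp : ℕ → ℝ} {τ : ℤ → ℝ}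
  {Xr : Fin 4 → ℤ → ℝ → ℝ} {W : Fin 3 → ℤ → ℝ → ℝ} {Er : ℤ → ℝ → ℝ}

/-- On `[0, T₁]` the energies `Ẽ_{-1}, Ẽ_0, Ẽ_1` are at most `1` (from `GoodAt`, `K ≥ 2`).
[cite: Tao2016AveragedNS, §6.5 p. 35] -/
theorem RescaledSplitHypotheses.energy_le_one_of_goodAt
    (h : RescaledSplitHypotheses γ ε₀ K ε C₁ C₂ C₃ n₀ N ηp βp τ Xr W Er) (hε₀ : 0 < ε₀) (hε₀1 : ε₀ < 1)
    (hK : 2 ≤ K) (hN : n₀ ≤ N) {t : ℝ} (ht : 0 ≤ t) (hg : GoodAt ε₀ K Xr Er t) {k : ℤ}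
    (hk : k = -1 ∨ k = 0 ∨ k = 1) : Er k t ≤ 1 := by
  have hτ : τ (n₀ - N) ≤ t := (h.tau_init_le hN).trans ht
  have h0 := h.nonneg_F 0 t hτ
  have h1 := h.nonneg_F 1 t hτ
  rcases hk with rfl | rfl | rfl
  · have hb := hg.before 2 le_rfl
    have hidx : (1 : ℤ) - ((2 : ℕ) : ℤ) = -1 := by norm_num
    rw [hidx] at hb
    have hq : (1 + ε₀) ^ ((((2 : ℕ) : ℝ)) / 10) ≤ 2 := by
      calc (1 + ε₀) ^ ((((2 : ℕ) : ℝ)) / 10) ≤ (1 + ε₀) ^ (1 : ℝ) :=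
            Real.rpow_le_rpow_of_exponent_le (by linarith) (by norm_num)
        _ ≤ 2 := by rw [Real.rpow_one]; linarith
    have hK10 : (K ^ 10)⁻¹ ≤ 1 / 2 := by
      rw [one_div]; apply inv_anti₀ (by norm_num)
      exact le_trans (by norm_num) (pow_le_pow_left₀ (by norm_num) hK 10)
    calc Er (-1) t ≤ (K ^ 10)⁻¹ * (1 + ε₀) ^ ((((2 : ℕ) : ℝ)) / 10) := hb
      _ ≤ 1 / 2 * 2 := mul_le_mul hK10 hq (by positivity) (by norm_num)
      _ = 1 := by norm_num
  · linarith [hg.during]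
  · linarith [hg.during]

/-- **Lemma 6.9 (almost all energy in primary modes)**, explicit: for `k ∈ {-1, 0, 1}` and
`t ∈ [0, T₁]` (more precisely: `t ∈ [0, 100]` with `GoodAt` on `[0, t]`),
`0 ≤ Ẽ_k(t) - ½(Σã_k² + ΣZ̃_k²)(t) ≤ primaryDefect ε₀ C₂ C₃ n₀` (the primary sum of the split system
includes the asymmetric energy `½ΣZ̃²`). [cite: Tao2016AveragedNS, §6.5 Lemma 6.9] -/
theorem RescaledSplitHypotheses.energy_sub_half_sum
    (h : RescaledSplitHypotheses γ ε₀ K ε C₁ C₂ C₃ n₀ N ηp βp τ Xr W Er) (hε₀ : 0 < ε₀) (hε₀1 : ε₀ < 1)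
    (hK : 2 ≤ K) (hC₂ : 0 ≤ C₂) (hC₃ : 0 ≤ C₃) (hN : n₀ ≤ N) {t : ℝ} (ht : t ∈ Icc (0 : ℝ) 100)
    (hg : ∀ s ∈ Icc 0 t, GoodAt ε₀ K Xr Er s) {k : ℤ} (hk : k = -1 ∨ k = 0 ∨ k = 1) :
    0 ≤ Er k t - (1 / 2) * (∑ i, Xr i k t ^ 2 + ∑ i, W i k t ^ 2) ∧
      Er k t - (1 / 2) * (∑ i, Xr i k t ^ 2 + ∑ i, W i k t ^ 2) ≤ primaryDefect ε₀ C₂ C₃ n₀ := by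
  have hq0 : (0 : ℝ) < 1 + ε₀ := by linarith
  have hq1 : (1 : ℝ) ≤ 1 + ε₀ := by linarith
  have hK1 : 1 ≤ K := by linarith
  have hτ0 : τ (n₀ - N) ≤ 0 := h.tau_init_le hN
  have hτ : τ (n₀ - N) ≤ t := hτ0.trans ht.1
  refine ⟨by linarith [h.defect_lower k t hτ], ?_⟩
  have hup := h.defect_upper k t hτ
  -- the integral over the past and over `[0, t]`
  have hpast := h.integral_energy_past_le_zero hε₀ hε₀1 hK1 hC₃ hN hk
  have hpresent : ∫ s in (0 : ℝ)..t, Er k s ≤ 100 := by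
    have hb : ∀ s ∈ Ι (0 : ℝ) t, ‖Er k s‖ ≤ 1 := by
      intro s hs
      rw [uIoc_of_le ht.1] at hs
      have hgs := hg s ⟨hs.1.le, hs.2⟩
      rw [Real.norm_eq_abs, abs_of_nonneg (h.nonneg_F k s (hτ0.trans hs.1.le))]
      exact h.energy_le_one_of_goodAt hε₀ hε₀1 hK hN hs.1.le hgs hk
    have := norm_integral_le_of_norm_le_const hb
    rw [Real.norm_eq_abs, sub_zero, abs_of_nonneg ht.1] at this
    have h2 := le_abs_self (∫ s in (0 : ℝ)..t, Er k s)
    nlinarith [ht.2]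
  have hint : ∫ s in (τ (n₀ - N))..t, Er k s ≤ cumEnergyConst ε₀ C₃ + 100 := by
    have hi1 : IntervalIntegrable (Er k) volume (τ (n₀ - N)) 0 :=
      (h.continuousOn_E k le_rfl).intervalIntegrable_of_Icc hτ0
    have hi2 : IntervalIntegrable (Er k) volume 0 t :=
      (h.continuousOn_E k hτ0).intervalIntegrable_of_Icc ht.1
    rw [← integral_add_adjacent_intervals hi1 hi2]
    linarith
  have hcoef : C₂ * (1 + ε₀) ^ ((2 : ℝ) * k - n₀ / 2) ≤
      C₂ * (1 + ε₀) ^ (2 : ℝ) * (1 + ε₀) ^ (-(n₀ : ℝ) / 2) := by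
    rw [mul_assoc, ← Real.rpow_add hq0]
    apply mul_le_mul_of_nonneg_left _ hC₂
    apply Real.rpow_le_rpow_of_exponent_le hq1
    have hk1 : (k : ℝ) ≤ 1 := by rcases hk with rfl | rfl | rfl <;> norm_num
    linarith
  have hint0 : 0 ≤ ∫ s in (τ (n₀ - N))..t, Er k s :=
    integral_nonneg hτ fun s hs => h.nonneg_F k s hs.1
  unfold primaryDefect
  calc Er k t - 1 / 2 * (∑ i, Xr i k t ^ 2 + ∑ i, W i k t ^ 2)
      ≤ C₂ * (1 + ε₀) ^ ((2 : ℝ) * k - n₀ / 2) * ∫ s in (τ (n₀ - N))..t, Er k s := by linarith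
    _ ≤ C₂ * (1 + ε₀) ^ (2 : ℝ) * (1 + ε₀) ^ (-(n₀ : ℝ) / 2) * (cumEnergyConst ε₀ C₃ + 100) :=
        mul_le_mul hcoef hint hint0 (by positivity)

/-! ## Lemma 6.10: closing some exits -/

/-- The integrated energy inequality (6.47♯) on `[0, T]`:
`Ẽ_k(T) ≤ Ẽ_k(0) + ∫_0^T K (1+ε₀)^{5k/2} ((d̃_{k-1}² - Z̃²_{d,k-1}) ã_k - (1+ε₀)^{5/2} (d̃_k² - Z̃²_{d,k}) ã_{k+1})`
("Integrating (6.47) on `[0, T₁]`", proof of Lemma 6.10). [cite: Tao2016AveragedNS, §6.5 Lemma 6.10] -/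
theorem RescaledSplitHypotheses.energy_le_init_add_integral
    (h : RescaledSplitHypotheses γ ε₀ K ε C₁ C₂ C₃ n₀ N ηp βp τ Xr W Er) (hN : n₀ ≤ N) (k : ℤ) {T : ℝ}
    (hT : 0 ≤ T) :
    Er k T ≤ Er k 0 + ∫ t in (0 : ℝ)..T, K * (1 + ε₀) ^ ((5 : ℝ) * k / 2) *
      ((Xr 3 (k - 1) t ^ 2 - W 2 (k - 1) t ^ 2) * Xr 0 k t -
        (1 + ε₀) ^ ((5 : ℝ) / 2) * (Xr 3 k t ^ 2 - W 2 k t ^ 2) * Xr 0 (k + 1) t) := by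
  have hτ0 : τ (n₀ - N) ≤ 0 := h.tau_init_le hN
  apply le_add_integral_of_deriv_right_le (b := T) (h.continuousOn_E k hτ0)
    (fun t ht => h.hasDeriv_E k (hτ0.trans ht.1))
  · apply ContinuousOn.mul continuousOn_const
    apply ContinuousOn.sub
    · exact (((h.continuousOn_X 3 (k - 1) hτ0).pow 2).sub
        ((h.continuousOn_W 2 (k - 1) hτ0).pow 2)).mul (h.continuousOn_X 0 k hτ0)
    · exact ((continuousOn_const.mul (((h.continuousOn_X 3 k hτ0).pow 2).sub
        ((h.continuousOn_W 2 k hτ0).pow 2))).mul (h.continuousOn_X 0 (k + 1) hτ0))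
  · intro t ht
    exact h.energy k t (hτ0.trans ht.1)
  · exact ⟨hT, le_rfl⟩

/-- Mode bounds inside the regime `GoodAt` (from `Xr_i² ≤ 2Ẽ`), as square bounds: for `j ≥ 2`,
`Xr_i(1-j)² ≤ 2 K^{-10} (1+ε₀)^{j/10}`; `Xr_i(0)², Xr_i(1)² ≤ 2`; for `j ≥ 1`,
`Xr_i(1+j)² ≤ 2 K^{-30} (1+ε₀)^{-10 j}`. [cite: Tao2016AveragedNS, §6.5 Lemma 6.10] -/
theorem RescaledSplitHypotheses.sq_bounds_of_goodAt
    (h : RescaledSplitHypotheses γ ε₀ K ε C₁ C₂ C₃ n₀ N ηp βp τ Xr W Er) (hN : n₀ ≤ N) {t : ℝ} (ht : 0 ≤ t)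
    (hg : GoodAt ε₀ K Xr Er t) (i : Fin 4) :
    (∀ j : ℕ, 2 ≤ j → Xr i (1 - j) t ^ 2 ≤ 2 * ((K ^ 10)⁻¹ * (1 + ε₀) ^ ((j : ℝ) / 10))) ∧
      Xr i 0 t ^ 2 ≤ 2 ∧ Xr i 1 t ^ 2 ≤ 2 ∧
      (∀ j : ℕ, 1 ≤ j → Xr i (1 + j) t ^ 2 ≤ 2 * ((K ^ 30)⁻¹ * (1 + ε₀) ^ (-(10 : ℝ) * j))) := by
  have hτ : τ (n₀ - N) ≤ t := (h.tau_init_le hN).trans ht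
  have hE0 := h.nonneg_F 0 t hτ
  have hE1 := h.nonneg_F 1 t hτ
  refine ⟨fun j hj => ?_, ?_, ?_, fun j hj => ?_⟩
  · exact (h.sq_le_two_mul_energy i _ hτ).trans (by linarith [hg.before j hj])
  · exact (h.sq_le_two_mul_energy i _ hτ).trans (by linarith [hg.during])
  · exact (h.sq_le_two_mul_energy i _ hτ).trans (by linarith [hg.during])
  · exact (h.sq_le_two_mul_energy i _ hτ).trans (by linarith [hg.after j hj])

/-- Two-way pump bounds inside the regime `GoodAt` (from `|d̃² - Z̃_d²| ≤ 2Ẽ`): for `j ≥ 2`,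
`|d̃²_{1-j} - Z̃²_{d,1-j}| ≤ 2 K^{-10} (1+ε₀)^{j/10}`; at scales `0, 1` the bound `2`; for `j ≥ 1`,
`|d̃²_{1+j} - Z̃²_{d,1+j}| ≤ 2 K^{-30} (1+ε₀)^{-10 j}` — the split substitutes for Tao's `d_j² ≤ 2Ẽ_j`.
[cite: Tao2016AveragedNS, §6.5 Lemma 6.10] -/
theorem RescaledSplitHypotheses.sqP_bounds_of_goodAt
    (h : RescaledSplitHypotheses γ ε₀ K ε C₁ C₂ C₃ n₀ N ηp βp τ Xr W Er) (hN : n₀ ≤ N) {t : ℝ}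
    (ht : 0 ≤ t) (hg : GoodAt ε₀ K Xr Er t) :
    (∀ j : ℕ, 2 ≤ j → |Xr 3 (1 - j) t ^ 2 - W 2 (1 - j) t ^ 2| ≤
        2 * ((K ^ 10)⁻¹ * (1 + ε₀) ^ ((j : ℝ) / 10))) ∧
      |Xr 3 0 t ^ 2 - W 2 0 t ^ 2| ≤ 2 ∧ |Xr 3 1 t ^ 2 - W 2 1 t ^ 2| ≤ 2 ∧
      (∀ j : ℕ, 1 ≤ j → |Xr 3 (1 + j) t ^ 2 - W 2 (1 + j) t ^ 2| ≤
        2 * ((K ^ 30)⁻¹ * (1 + ε₀) ^ (-(10 : ℝ) * j))) := by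
  have hτ : τ (n₀ - N) ≤ t := (h.tau_init_le hN).trans ht
  have hE0 := h.nonneg_F 0 t hτ
  have hE1 := h.nonneg_F 1 t hτ
  refine ⟨fun j hj => ?_, ?_, ?_, fun j hj => ?_⟩
  · exact (h.abs_sq_sub_sqW_le_two_mul_energy _ hτ).trans (by linarith [hg.before j hj])
  · exact (h.abs_sq_sub_sqW_le_two_mul_energy _ hτ).trans (by linarith [hg.during])
  · exact (h.abs_sq_sub_sqW_le_two_mul_energy _ hτ).trans (by linarith [hg.during])
  · exact (h.abs_sq_sub_sqW_le_two_mul_energy _ hτ).trans (by linarith [hg.after j hj])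

/-- `|p y| ≤ α β` from `|p| ≤ α`, `|y| ≤ β`. [folklore] -/
private theorem abs_mul_le_of_abs_le {p y α β : ℝ} (hp : |p| ≤ α) (hy : |y| ≤ β) : |p * y| ≤ α * β := by
  rw [abs_mul]
  exact mul_le_mul hp hy (abs_nonneg _) ((abs_nonneg p).trans hp)

/-- Bounding the SPLIT flux `K Λ_k ((d̃²_{k-1} - Z̃²_{d,k-1}) ã_k - Λ (d̃²_k - Z̃²_{d,k}) ã_{k+1})` from bounds
on its four factors: if `|d̃_{k-1}² - Z̃²_{d,k-1}| ≤ α`, `|ã_k| ≤ β`, `|d̃_k² - Z̃²_{d,k}| ≤ γ'`, `|ã_{k+1}| ≤ δ`,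
then `|A_k| ≤ K (q^{5k/2} α β + q^{5k/2} q^{5/2} γ' δ)` — the shape of the tree's `abs_flux_le`.
[cite: Tao2016AveragedNS, §6.5 Lemma 6.10] -/
theorem abs_splitFlux_le {ε₀ K : ℝ} {Xr : Fin 4 → ℤ → ℝ → ℝ} {W : Fin 3 → ℤ → ℝ → ℝ} {k : ℤ}
    {t : ℝ} (hε₀ : 0 < ε₀) (hK : 0 < K) {α β γ' δ : ℝ}
    (h1 : |Xr 3 (k - 1) t ^ 2 - W 2 (k - 1) t ^ 2| ≤ α) (h2 : |Xr 0 k t| ≤ β)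
    (h3 : |Xr 3 k t ^ 2 - W 2 k t ^ 2| ≤ γ') (h4 : |Xr 0 (k + 1) t| ≤ δ) :
    |K * (1 + ε₀) ^ ((5 : ℝ) * k / 2) *
        ((Xr 3 (k - 1) t ^ 2 - W 2 (k - 1) t ^ 2) * Xr 0 k t -
          (1 + ε₀) ^ ((5 : ℝ) / 2) * (Xr 3 k t ^ 2 - W 2 k t ^ 2) * Xr 0 (k + 1) t)| ≤
      K * ((1 + ε₀) ^ ((5 : ℝ) * k / 2) * (α * β) +
        (1 + ε₀) ^ ((5 : ℝ) * k / 2) * (1 + ε₀) ^ ((5 : ℝ) / 2) * (γ' * δ)) := by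
  have hq0 : (0 : ℝ) < 1 + ε₀ := by linarith
  have hP : 0 < (1 + ε₀) ^ ((5 : ℝ) * k / 2) := Real.rpow_pos_of_pos hq0 _
  have hP5 : 0 < (1 + ε₀) ^ ((5 : ℝ) / 2) := Real.rpow_pos_of_pos hq0 _
  have t1 := abs_mul_le_of_abs_le h1 h2
  have t2 := abs_mul_le_of_abs_le h3 h4
  rw [abs_mul, abs_mul, abs_of_pos hK, abs_of_pos hP]
  have e : (1 + ε₀) ^ ((5 : ℝ) / 2) * (Xr 3 k t ^ 2 - W 2 k t ^ 2) * Xr 0 (k + 1) t =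
      (1 + ε₀) ^ ((5 : ℝ) / 2) * ((Xr 3 k t ^ 2 - W 2 k t ^ 2) * Xr 0 (k + 1) t) := by ring
  rw [e]
  have htri : |(Xr 3 (k - 1) t ^ 2 - W 2 (k - 1) t ^ 2) * Xr 0 k t - (1 + ε₀) ^ ((5 : ℝ) / 2) *
      ((Xr 3 k t ^ 2 - W 2 k t ^ 2) * Xr 0 (k + 1) t)| ≤ α * β + (1 + ε₀) ^ ((5 : ℝ) / 2) * (γ' * δ) := by
    refine (abs_sub _ _).trans (add_le_add t1 ?_)
    rw [abs_mul, abs_of_pos hP5]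
    exact mul_le_mul_of_nonneg_left t2 hP5.le
  calc K * (1 + ε₀) ^ ((5 : ℝ) * k / 2) * |(Xr 3 (k - 1) t ^ 2 - W 2 (k - 1) t ^ 2) * Xr 0 k t -
        (1 + ε₀) ^ ((5 : ℝ) / 2) * ((Xr 3 k t ^ 2 - W 2 k t ^ 2) * Xr 0 (k + 1) t)|
      ≤ K * (1 + ε₀) ^ ((5 : ℝ) * k / 2) * (α * β + (1 + ε₀) ^ ((5 : ℝ) / 2) * (γ' * δ)) :=
        mul_le_mul_of_nonneg_left htri (by positivity)
    _ = _ := by ring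

set_option maxHeartbeats 800000 in -- the split fluxes carry two extra squares per interface; same proof as the tree's, ~2× elaboration cost
/-- **Lemma 6.10, (6.91) "near exit"**: `Ẽ_0(T) + Ẽ_1(T) < 1` at every `T ∈ [0, 100]` up to which
`GoodAt` holds and the fresh shell's hand-off asymmetry obeys `|Z̃_{d,1}| ≤ ζ`, `ζ² ≤ ¼K⁻²⁰` (the flux
`(d̃_{-1}² - Z̃²_{d,-1}) ã_0 - (1+ε₀)^5 (d̃_1² - Z̃²_{d,1}) ã_2` is `O(K^{-9})`, integrated over a time `≤ 100`,
on top of `Ẽ_0(0)+Ẽ_1(0) ≤ 0.6`). Largeness used: `10⁸ ≤ ε₀ K⁴`. [cite: Tao2016AveragedNS, §6.5 Lemma 6.10] -/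
theorem RescaledSplitHypotheses.exit_near
    (h : RescaledSplitHypotheses γ ε₀ K ε C₁ C₂ C₃ n₀ N ηp βp τ Xr W Er) (hε₀ : 0 < ε₀) (hε₀1 : ε₀ < 1)
    (hγ1 : γ ≤ 1 / 10 ^ 5) (hK : 0 < K) (hKε : 10 ^ 8 ≤ ε₀ * K ^ 4) (hε : 0 < ε) (hε1 : ε ≤ 1)
    (hC₂ : 0 ≤ C₂) (hC₃ : 0 ≤ C₃) (hN : n₀ ≤ N)
    (hn : C₂ * (1 + ε₀) ^ (-(n₀ : ℝ) / 2) * cumEnergyConst ε₀ C₃ ≤ 1 / 100)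
    (hη0 : ηp 0 ≤ 1 / 10 ^ 3)
    {T : ℝ} (hT : T ∈ Icc (0 : ℝ) 100) (hg : ∀ t ∈ Icc 0 T, GoodAt ε₀ K Xr Er t)
    {ζ : ℝ} (hζ : ∀ t ∈ Icc 0 T, |W 2 1 t| ≤ ζ) (hζK : ζ ^ 2 ≤ 1 / 4 * (K ^ 20)⁻¹) :
    Er 0 T + Er 1 T < 1 := by
  have hq0 : (0 : ℝ) < 1 + ε₀ := by linarith
  have hq1 : (1 : ℝ) ≤ 1 + ε₀ := by linarith
  have hq2 : (1 + ε₀ : ℝ) ≤ 2 := by linarith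
  have hK100 := hundred_le_of_regime hε₀1 hK hKε
  have hK10 : (10 : ℝ) ≤ K := by linarith
  have hK2 : (2 : ℝ) ≤ K := by linarith
  have hτ0 : τ (n₀ - N) ≤ 0 := h.tau_init_le hN
  have h0 := h.energy_le_init_add_integral hN 0 hT.1
  have h1 := h.energy_le_init_add_integral hN 1 hT.1
  have hinit := h.energy_zero_during hε₀ hε₀1 hγ1 hK2 hε hε1 hC₂ hC₃ hN hn hη0
  -- the two fluxes
  set A0 : ℝ → ℝ := fun t => K * (1 + ε₀) ^ ((5 : ℝ) * ((0 : ℤ) : ℝ) / 2) *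
    ((Xr 3 (0 - 1) t ^ 2 - W 2 (0 - 1) t ^ 2) * Xr 0 0 t -
      (1 + ε₀) ^ ((5 : ℝ) / 2) * (Xr 3 0 t ^ 2 - W 2 0 t ^ 2) * Xr 0 (0 + 1) t)
    with hA0
  set A1 : ℝ → ℝ := fun t => K * (1 + ε₀) ^ ((5 : ℝ) * ((1 : ℤ) : ℝ) / 2) *
    ((Xr 3 (1 - 1) t ^ 2 - W 2 (1 - 1) t ^ 2) * Xr 0 1 t -
      (1 + ε₀) ^ ((5 : ℝ) / 2) * (Xr 3 1 t ^ 2 - W 2 1 t ^ 2) * Xr 0 (1 + 1) t)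
    with hA1
  have hcont : ∀ (i : Fin 4) (k : ℤ), ContinuousOn (Xr i k) (Icc 0 T) := fun i k =>
    h.continuousOn_X i k hτ0
  have hcontW : ∀ (i : Fin 3) (k : ℤ), ContinuousOn (W i k) (Icc 0 T) := fun i k =>
    h.continuousOn_W i k hτ0
  have hA0c : ContinuousOn A0 (Icc 0 T) := by
    apply ContinuousOn.mul continuousOn_const
    exact ((((hcont 3 (0 - 1)).pow 2).sub ((hcontW 2 (0 - 1)).pow 2)).mul (hcont 0 0)).sub
      ((continuousOn_const.mul (((hcont 3 0).pow 2).sub ((hcontW 2 0).pow 2))).mul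
        (hcont 0 (0 + 1)))
  have hA1c : ContinuousOn A1 (Icc 0 T) := by
    apply ContinuousOn.mul continuousOn_const
    exact ((((hcont 3 (1 - 1)).pow 2).sub ((hcontW 2 (1 - 1)).pow 2)).mul (hcont 0 1)).sub
      ((continuousOn_const.mul (((hcont 3 1).pow 2).sub ((hcontW 2 1).pow 2))).mul
        (hcont 0 (1 + 1)))
  have hsum : (∫ t in (0 : ℝ)..T, A0 t) + (∫ t in (0 : ℝ)..T, A1 t) =
      ∫ t in (0 : ℝ)..T, (A0 t + A1 t) :=
    (intervalIntegral.integral_add (hA0c.intervalIntegrable_of_Icc hT.1)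
      (hA1c.intervalIntegrable_of_Icc hT.1)).symm
  -- pointwise the sum is `K (d_{-1}² a_0 - q^5 d_1² a_2)`
  have hq5 : (1 + ε₀) ^ ((5 : ℝ) / 2) * (1 + ε₀) ^ ((5 : ℝ) / 2) = (1 + ε₀) ^ (5 : ℝ) := by
    rw [← Real.rpow_add hq0]; norm_num
  have hpt : ∀ t, A0 t + A1 t =
      K * ((Xr 3 (-1) t ^ 2 - W 2 (-1) t ^ 2) * Xr 0 0 t -
        (1 + ε₀) ^ (5 : ℝ) * (Xr 3 1 t ^ 2 - W 2 1 t ^ 2) * Xr 0 2 t) := by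
    intro t
    simp only [hA0, hA1]
    have e1 : (1 + ε₀) ^ ((5 : ℝ) * ((0 : ℤ) : ℝ) / 2) = 1 := by norm_num
    have e2 : (1 + ε₀) ^ ((5 : ℝ) * ((1 : ℤ) : ℝ) / 2) = (1 + ε₀) ^ ((5 : ℝ) / 2) := by norm_num
    rw [e1, e2, ← hq5]
    norm_num
    ring
  -- pointwise bound `|A0 + A1| ≤ 7 K^{-9}`
  have hbound : ∀ t ∈ Icc 0 T, |A0 t + A1 t| ≤ 7 * (K ^ 9)⁻¹ := by
    intro t ht
    have hgt := hg t ht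
    obtain ⟨hb3, -, -, -⟩ := h.sqP_bounds_of_goodAt hN ht.1 hgt
    obtain ⟨-, ha0, -, hpost0⟩ := h.sq_bounds_of_goodAt hN ht.1 hgt 0
    have hd1 : |Xr 3 1 t ^ 2 - W 2 1 t ^ 2| ≤ 1 / 2 * (K ^ 20)⁻¹ := by
      have hd := hgt.d_le
      have hw := hζ t ht
      have h2 : Xr 3 1 t ^ 2 ≤ 1 / 4 * (K ^ 20)⁻¹ := by
        rw [← sq_abs]
        calc |Xr 3 1 t| ^ 2 ≤ (1 / 2 * (K ^ 10)⁻¹) ^ 2 := pow_le_pow_left₀ (abs_nonneg _) hd 2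
          _ = 1 / 4 * (K ^ 20)⁻¹ := by rw [mul_pow, inv_pow, ← pow_mul]; norm_num
      have h3 : W 2 1 t ^ 2 ≤ 1 / 4 * (K ^ 20)⁻¹ := by
        rw [← sq_abs]
        exact (pow_le_pow_left₀ (abs_nonneg _) hw 2).trans hζK
      rw [abs_le]
      constructor <;> nlinarith [sq_nonneg (Xr 3 1 t), sq_nonneg (W 2 1 t)]
    -- `|d_{-1}² - Z_{d,-1}²| ≤ 4 K^{-10}`
    have hdm1 : |Xr 3 (-1) t ^ 2 - W 2 (-1) t ^ 2| ≤ 4 * (K ^ 10)⁻¹ := by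
      have := hb3 2 le_rfl
      have hidx : (1 : ℤ) - ((2 : ℕ) : ℤ) = -1 := by norm_num
      rw [hidx] at this
      have hq : (1 + ε₀) ^ ((((2 : ℕ) : ℝ)) / 10) ≤ 2 :=
        (Real.rpow_le_rpow_of_exponent_le hq1 (by norm_num : (((2 : ℕ) : ℝ)) / 10 ≤ 1)).trans
          (by rw [Real.rpow_one]; linarith)
      have hK10i : 0 ≤ (K ^ 10)⁻¹ := by positivity
      exact this.trans (by nlinarith)
    -- `|a_0| ≤ 3/2`, `|a_2| ≤ 2 K^{-15}`
    have ha0' : |Xr 0 0 t| ≤ 3 / 2 := abs_le_of_sq_le_sq (by linarith) (by norm_num)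
    have ha2' : |Xr 0 2 t| ≤ 2 * (K ^ 15)⁻¹ := by
      have := hpost0 1 le_rfl
      have hidx : (1 : ℤ) + ((1 : ℕ) : ℤ) = 2 := by norm_num
      rw [hidx] at this
      apply abs_le_of_sq_le_sq _ (by positivity)
      have hq : (1 + ε₀) ^ (-(10 : ℝ) * ((1 : ℕ) : ℝ)) ≤ 1 :=
        Real.rpow_le_one_of_one_le_of_nonpos hq1 (by norm_num)
      have hK30 : 0 ≤ (K ^ 30)⁻¹ := by positivity
      calc Xr 0 2 t ^ 2 ≤ 2 * ((K ^ 30)⁻¹ * (1 + ε₀) ^ (-(10 : ℝ) * ((1 : ℕ) : ℝ))) := this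
        _ ≤ 2 * ((K ^ 30)⁻¹ * 1) := by gcongr
        _ ≤ (2 * (K ^ 15)⁻¹) ^ 2 := by
            rw [mul_pow, inv_pow, ← pow_mul]; norm_num
            nlinarith
    have hq5le : (1 + ε₀) ^ (5 : ℝ) ≤ 32 := by
      calc (1 + ε₀) ^ (5 : ℝ) ≤ (2 : ℝ) ^ (5 : ℝ) := Real.rpow_le_rpow hq0.le hq2 (by norm_num)
        _ = 32 := by norm_num
    have t1 := abs_mul_le_of_abs_le hdm1 ha0'
    have t2 := abs_mul_le_of_abs_le hd1 ha2'
    rw [hpt t, abs_mul, abs_of_pos hK]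
    have htri : |(Xr 3 (-1) t ^ 2 - W 2 (-1) t ^ 2) * Xr 0 0 t -
        (1 + ε₀) ^ (5 : ℝ) * (Xr 3 1 t ^ 2 - W 2 1 t ^ 2) * Xr 0 2 t| ≤
        4 * (K ^ 10)⁻¹ * (3 / 2) + 32 * (1 / 2 * (K ^ 20)⁻¹ * (2 * (K ^ 15)⁻¹)) := by
      have e : (1 + ε₀) ^ (5 : ℝ) * (Xr 3 1 t ^ 2 - W 2 1 t ^ 2) * Xr 0 2 t =
          (1 + ε₀) ^ (5 : ℝ) * ((Xr 3 1 t ^ 2 - W 2 1 t ^ 2) * Xr 0 2 t) := by ring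
      rw [e]
      refine (abs_sub _ _).trans (add_le_add t1 ?_)
      rw [abs_mul, abs_of_pos (Real.rpow_pos_of_pos hq0 _)]
      exact mul_le_mul hq5le t2 (abs_nonneg _) (by norm_num)
    -- `K (6 K^{-10} + 32 K^{-35}) ≤ 7 K^{-9}`
    have hK9 : K * (4 * (K ^ 10)⁻¹ * (3 / 2) + 32 * (1 / 2 * (K ^ 20)⁻¹ * (2 * (K ^ 15)⁻¹))) ≤
        7 * (K ^ 9)⁻¹ := by
      have hK25 : (32 : ℝ) ≤ K ^ 25 := le_trans (by norm_num) (pow_le_pow_left₀ (by norm_num) hK2 25)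
      field_simp
      nlinarith [pow_pos hK 9, pow_pos hK 25]
    calc K * |(Xr 3 (-1) t ^ 2 - W 2 (-1) t ^ 2) * Xr 0 0 t -
          (1 + ε₀) ^ (5 : ℝ) * (Xr 3 1 t ^ 2 - W 2 1 t ^ 2) * Xr 0 2 t|
        ≤ K * (4 * (K ^ 10)⁻¹ * (3 / 2) + 32 * (1 / 2 * (K ^ 20)⁻¹ * (2 * (K ^ 15)⁻¹))) :=
          mul_le_mul_of_nonneg_left htri hK.le
      _ ≤ 7 * (K ^ 9)⁻¹ := hK9
  have hint := integral_le_hundred_mul hT (by positivity) hbound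
  -- conclude: `0.6 + 700 K^{-9} < 1`
  have hK9 : 700 * (K ^ 9)⁻¹ < 2 / 5 := by
    rw [← div_eq_mul_inv, div_lt_iff₀ (by positivity)]
    have : (10 : ℝ) ^ 9 ≤ K ^ 9 := pow_le_pow_left₀ (by norm_num) hK10 9
    nlinarith
  have hA0i : Er 0 T ≤ Er 0 0 + ∫ t in (0 : ℝ)..T, A0 t := h0
  have hA1i : Er 1 T ≤ Er 1 0 + ∫ t in (0 : ℝ)..T, A1 t := h1
  linarith [hsum]

set_option maxHeartbeats 800000 in -- the split fluxes carry two extra squares per interface; same proof as the tree's, ~2× elaboration cost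
/-- **Lemma 6.10, (6.89) "far exit"**: `Ẽ_{1-m}(T) < K^{-10}(1+ε₀)^{m/10}` for `m ≥ 3`, at every
`T ∈ [0, 100]` up to which `GoodAt` holds. Largeness used: `10⁸ ≤ ε₀ K⁴` (to absorb the factor
`(1+ε₀)^{-0.08}` of Lemma 6.8 against the `O(K^{-14})` flux). [cite: Tao2016AveragedNS, §6.5 Lemma 6.10] -/
theorem RescaledSplitHypotheses.exit_far
    (h : RescaledSplitHypotheses γ ε₀ K ε C₁ C₂ C₃ n₀ N ηp βp τ Xr W Er) (hε₀ : 0 < ε₀) (hε₀1 : ε₀ < 1)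
    (hK : 0 < K) (hKε : 10 ^ 8 ≤ ε₀ * K ^ 4) (hN : n₀ ≤ N)
    {T : ℝ} (hT : T ∈ Icc (0 : ℝ) 100) (hg : ∀ t ∈ Icc 0 T, GoodAt ε₀ K Xr Er t)
    (m : ℕ) (hm : 3 ≤ m) :
    Er (1 - m) T < (K ^ 10)⁻¹ * (1 + ε₀) ^ ((m : ℝ) / 10) := by
  have hq0 : (0 : ℝ) < 1 + ε₀ := by linarith
  have hq1 : (1 : ℝ) ≤ 1 + ε₀ := by linarith
  have hK100 := hundred_le_of_regime hε₀1 hK hKε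
  have hK1 : (1 : ℝ) ≤ K := by linarith
  have hτ0 : τ (n₀ - N) ≤ 0 := h.tau_init_le hN
  set k : ℤ := 1 - m with hk
  have hinit := h.energy_zero_before hε₀ hK1 hN m (by omega)
  have hineq := h.energy_le_init_add_integral hN k hT.1
  -- pointwise flux bound `|A_k| ≤ 8 K^{-14}`
  have hbound : ∀ t ∈ Icc 0 T, |K * (1 + ε₀) ^ ((5 : ℝ) * k / 2) *
      ((Xr 3 (k - 1) t ^ 2 - W 2 (k - 1) t ^ 2) * Xr 0 k t -
        (1 + ε₀) ^ ((5 : ℝ) / 2) * (Xr 3 k t ^ 2 - W 2 k t ^ 2) * Xr 0 (k + 1) t)| ≤ 8 * (K ^ 14)⁻¹ := by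
    intro t ht
    have hgt := hg t ht
    obtain ⟨hb3, -, -, -⟩ := h.sqP_bounds_of_goodAt hN ht.1 hgt
    obtain ⟨hb0, -, -, -⟩ := h.sq_bounds_of_goodAt hN ht.1 hgt 0
    -- the four factor bounds
    have h1 : |Xr 3 (k - 1) t ^ 2 - W 2 (k - 1) t ^ 2| ≤
        2 * ((K ^ 10)⁻¹ * (1 + ε₀) ^ (((m + 1 : ℕ) : ℝ) / 10)) := by
      have := hb3 (m + 1) (by omega)
      have hidx : (1 : ℤ) - ((m + 1 : ℕ) : ℤ) = k - 1 := by rw [hk]; push_cast; ring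
      rwa [hidx] at this
    have h2 : |Xr 0 k t| ≤ 2 * (K ^ 5)⁻¹ * (1 + ε₀) ^ ((m : ℝ) / 20) := by
      have := hb0 m (by omega)
      apply abs_le_of_sq_le_sq _ (by positivity)
      calc Xr 0 k t ^ 2 = Xr 0 (1 - m) t ^ 2 := by rw [hk]
        _ ≤ 2 * ((K ^ 10)⁻¹ * (1 + ε₀) ^ ((m : ℝ) / 10)) := this
        _ ≤ (2 * (K ^ 5)⁻¹ * (1 + ε₀) ^ ((m : ℝ) / 20)) ^ 2 := by
            have hsq : ((1 + ε₀) ^ ((m : ℝ) / 20)) ^ 2 = (1 + ε₀) ^ ((m : ℝ) / 10) := by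
              rw [sq, ← Real.rpow_add hq0]; congr 1; ring
            rw [mul_pow, mul_pow, hsq, inv_pow, ← pow_mul]
            have : 0 ≤ (K ^ 10)⁻¹ * (1 + ε₀) ^ ((m : ℝ) / 10) := by positivity
            norm_num; nlinarith
    have h3 : |Xr 3 k t ^ 2 - W 2 k t ^ 2| ≤ 2 * ((K ^ 10)⁻¹ * (1 + ε₀) ^ ((m : ℝ) / 10)) := by
      have := hb3 m (by omega); rwa [← hk] at this
    have h4 : |Xr 0 (k + 1) t| ≤ 2 * (K ^ 5)⁻¹ * (1 + ε₀) ^ (((m - 1 : ℕ) : ℝ) / 20) := by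
      have := hb0 (m - 1) (by omega)
      have hidx : (1 : ℤ) - ((m - 1 : ℕ) : ℤ) = k + 1 := by
        rw [hk, Nat.cast_sub (by omega)]; push_cast; ring
      rw [hidx] at this
      apply abs_le_of_sq_le_sq _ (by positivity)
      calc Xr 0 (k + 1) t ^ 2 ≤ 2 * ((K ^ 10)⁻¹ * (1 + ε₀) ^ (((m - 1 : ℕ) : ℝ) / 10)) := this
        _ ≤ (2 * (K ^ 5)⁻¹ * (1 + ε₀) ^ (((m - 1 : ℕ) : ℝ) / 20)) ^ 2 := by
            have hsq : ((1 + ε₀) ^ (((m - 1 : ℕ) : ℝ) / 20)) ^ 2 =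
                (1 + ε₀) ^ (((m - 1 : ℕ) : ℝ) / 10) := by
              rw [sq, ← Real.rpow_add hq0]; congr 1; ring
            rw [mul_pow, mul_pow, hsq, inv_pow, ← pow_mul]
            have : 0 ≤ (K ^ 10)⁻¹ * (1 + ε₀) ^ (((m - 1 : ℕ) : ℝ) / 10) := by positivity
            norm_num; nlinarith
    have hA := abs_splitFlux_le hε₀ hK h1 h2 h3 h4
    refine hA.trans ?_
    -- exponent bookkeeping: both products of powers of `q` are `≤ 1` for `m ≥ 3`
    have hm3 : (3 : ℝ) ≤ m := by exact_mod_cast hm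
    have hkR : (k : ℝ) = 1 - m := by rw [hk]; push_cast; ring
    have hm1R : ((m - 1 : ℕ) : ℝ) = m - 1 := by rw [Nat.cast_sub (by omega)]; push_cast; ring
    have hmp1R : ((m + 1 : ℕ) : ℝ) = m + 1 := by push_cast; ring
    have e1 : (1 + ε₀) ^ ((5 : ℝ) * k / 2) * (1 + ε₀) ^ (((m + 1 : ℕ) : ℝ) / 10) *
        (1 + ε₀) ^ ((m : ℝ) / 20) ≤ 1 :=
      rpow3_le_one hq1 (by rw [hkR, hmp1R]; nlinarith)
    have e2 : (1 + ε₀) ^ ((5 : ℝ) * k / 2) * (1 + ε₀) ^ ((5 : ℝ) / 2) *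
        (1 + ε₀) ^ ((m : ℝ) / 10) * (1 + ε₀) ^ (((m - 1 : ℕ) : ℝ) / 20) ≤ 1 := by
      have := rpow4_le_rpow hq1 (q := 1 + ε₀) (a := (5 : ℝ) * k / 2) (b := (5 : ℝ) / 2)
        (c := (m : ℝ) / 10) (d := ((m - 1 : ℕ) : ℝ) / 20) (e := 0) (by rw [hkR, hm1R]; nlinarith)
      simpa using this
    have hK5 : 0 < (K ^ 5)⁻¹ := by positivity
    have hK10 : 0 < (K ^ 10)⁻¹ := by positivity
    have hP1 : 0 ≤ (1 + ε₀) ^ ((5 : ℝ) * k / 2) := (Real.rpow_pos_of_pos hq0 _).le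
    -- reorganise the bound into `K · K^{-15} · (4 e1 + 4 e2)`
    have hre : K * ((1 + ε₀) ^ ((5 : ℝ) * k / 2) *
        (2 * ((K ^ 10)⁻¹ * (1 + ε₀) ^ (((m + 1 : ℕ) : ℝ) / 10)) *
          (2 * (K ^ 5)⁻¹ * (1 + ε₀) ^ ((m : ℝ) / 20))) +
        (1 + ε₀) ^ ((5 : ℝ) * k / 2) * (1 + ε₀) ^ ((5 : ℝ) / 2) *
          (2 * ((K ^ 10)⁻¹ * (1 + ε₀) ^ ((m : ℝ) / 10)) *
            (2 * (K ^ 5)⁻¹ * (1 + ε₀) ^ (((m - 1 : ℕ) : ℝ) / 20)))) =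
        4 * (K * ((K ^ 10)⁻¹ * (K ^ 5)⁻¹)) *
          ((1 + ε₀) ^ ((5 : ℝ) * k / 2) * (1 + ε₀) ^ (((m + 1 : ℕ) : ℝ) / 10) *
            (1 + ε₀) ^ ((m : ℝ) / 20) +
          (1 + ε₀) ^ ((5 : ℝ) * k / 2) * (1 + ε₀) ^ ((5 : ℝ) / 2) *
            (1 + ε₀) ^ ((m : ℝ) / 10) * (1 + ε₀) ^ (((m - 1 : ℕ) : ℝ) / 20)) := by ring
    rw [hre]
    have hKK : K * ((K ^ 10)⁻¹ * (K ^ 5)⁻¹) = (K ^ 14)⁻¹ := by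
      field_simp
    rw [hKK]
    have : 0 < (K ^ 14)⁻¹ := by positivity
    nlinarith
  -- integrate and compare
  have hint := integral_le_hundred_mul hT (by positivity) hbound
  have hnum : (1 + ε₀) ^ (-(2 : ℝ) / 25) ≤ 1 - (2 : ℝ) / 25 * ε₀ / 4 := by
    have := rpow_neg_le_one_sub hε₀ hε₀1.le (p := (2 : ℝ) / 25) (by norm_num) (by norm_num)
    convert this using 2; ring
  have hqm : (1 : ℝ) ≤ (1 + ε₀) ^ ((m : ℝ) / 10) := Real.one_le_rpow hq1 (by positivity)
  have hK10pos : 0 < (K ^ 10)⁻¹ := by positivity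
  -- `800 K^{-14} < (ε₀/50) K^{-10}` from `10⁸ ≤ ε₀ K⁴`
  have hkey : 800 * (K ^ 14)⁻¹ < ε₀ / 50 * (K ^ 10)⁻¹ := by
    have h14 : (K ^ 14)⁻¹ = (K ^ 4)⁻¹ * (K ^ 10)⁻¹ := by rw [← mul_inv, ← pow_add]
    have h4 : 800 * (K ^ 4)⁻¹ < ε₀ / 50 := by
      rw [← div_eq_mul_inv, div_lt_iff₀ (by positivity)]
      nlinarith
    calc 800 * (K ^ 14)⁻¹ = (800 * (K ^ 4)⁻¹) * (K ^ 10)⁻¹ := by rw [h14]; ring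
      _ < ε₀ / 50 * (K ^ 10)⁻¹ := mul_lt_mul_of_pos_right h4 hK10pos
  have hflux : Er k T ≤ Er k 0 + ∫ t in (0 : ℝ)..T, K * (1 + ε₀) ^ ((5 : ℝ) * k / 2) *
      ((Xr 3 (k - 1) t ^ 2 - W 2 (k - 1) t ^ 2) * Xr 0 k t -
        (1 + ε₀) ^ ((5 : ℝ) / 2) * (Xr 3 k t ^ 2 - W 2 k t ^ 2) * Xr 0 (k + 1) t) := hineq
  have hEk0 : Er k 0 ≤ (1 - (2 : ℝ) / 25 * ε₀ / 4) * ((K ^ 10)⁻¹ * (1 + ε₀) ^ ((m : ℝ) / 10)) := by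
    rw [hk]
    exact hinit.trans (mul_le_mul_of_nonneg_right hnum (by positivity))
  have hlast : ε₀ / 50 * (K ^ 10)⁻¹ ≤ ε₀ / 50 * ((K ^ 10)⁻¹ * (1 + ε₀) ^ ((m : ℝ) / 10)) := by
    apply mul_le_mul_of_nonneg_left _ (by positivity)
    nlinarith [hqm, hK10pos]
  linarith [hflux, hEk0, hint, hkey, hlast]

set_option maxHeartbeats 800000 in -- the split fluxes carry two extra squares per interface; same proof as the tree's, ~2× elaboration cost
/-- **Lemma 6.10, (6.90) "second far exit"**: `Ẽ_{1+m}(T) < K^{-30}(1+ε₀)^{-10m}` for `m ≥ 1`,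
at every `T ∈ [0, 100]` up to which `GoodAt` holds and `|Z̃_{d,1}| ≤ ζ` with `ζ² ≤ ¼K⁻²⁰` (needed at
the interface `1 → 2` only, i.e. for `m = 1`). Largeness used: `10⁸ ≤ ε₀ K⁴`. [cite: Tao2016AveragedNS, §6.5 Lemma 6.10] -/
theorem RescaledSplitHypotheses.exit_far2
    (h : RescaledSplitHypotheses γ ε₀ K ε C₁ C₂ C₃ n₀ N ηp βp τ Xr W Er) (hε₀ : 0 < ε₀) (hε₀1 : ε₀ < 1)
    (hK : 0 < K) (hKε : 10 ^ 8 ≤ ε₀ * K ^ 4) (hN : n₀ ≤ N)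
    {T : ℝ} (hT : T ∈ Icc (0 : ℝ) 100) (hg : ∀ t ∈ Icc 0 T, GoodAt ε₀ K Xr Er t)
    {ζ : ℝ} (hζ : ∀ t ∈ Icc 0 T, |W 2 1 t| ≤ ζ) (hζK : ζ ^ 2 ≤ 1 / 4 * (K ^ 20)⁻¹)
    (m : ℕ) (hm : 1 ≤ m) :
    Er (1 + m) T < (K ^ 30)⁻¹ * (1 + ε₀) ^ (-(10 : ℝ) * m) := by
  have hq0 : (0 : ℝ) < 1 + ε₀ := by linarith
  have hq1 : (1 : ℝ) ≤ 1 + ε₀ := by linarith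
  have hq2 : (1 + ε₀ : ℝ) ≤ 2 := by linarith
  have hK100 := hundred_le_of_regime hε₀1 hK hKε
  have hK1 : (1 : ℝ) ≤ K := by linarith
  have hτ0 : τ (n₀ - N) ≤ 0 := h.tau_init_le hN
  set k : ℤ := 1 + m with hk
  have hinit := h.energy_zero_after hε₀ hK hN m hm
  have hineq := h.energy_le_init_add_integral hN k hT.1
  have hmR : (1 : ℝ) ≤ m := by exact_mod_cast hm
  have hkR : (k : ℝ) = 1 + m := by rw [hk]; push_cast; ring
  -- pointwise flux bound `|A_k| ≤ 33000 K^{-34} q^{-10 m}`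
  have hbound : ∀ t ∈ Icc 0 T, |K * (1 + ε₀) ^ ((5 : ℝ) * k / 2) *
      ((Xr 3 (k - 1) t ^ 2 - W 2 (k - 1) t ^ 2) * Xr 0 k t -
        (1 + ε₀) ^ ((5 : ℝ) / 2) * (Xr 3 k t ^ 2 - W 2 k t ^ 2) * Xr 0 (k + 1) t)| ≤
      33000 * (K ^ 34)⁻¹ * (1 + ε₀) ^ (-(10 : ℝ) * m) := by
    intro t ht
    have hgt := hg t ht
    obtain ⟨-, -, -, hp3⟩ := h.sqP_bounds_of_goodAt hN ht.1 hgt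
    obtain ⟨-, -, -, hp0⟩ := h.sq_bounds_of_goodAt hN ht.1 hgt 0
    -- `|d_m² - Z_{d,m}²| ≤ 2 K^{-20} q^{-10(m-1)}` (from `|d_1| ≤ ½K^{-10}` and `|Z̃_{d,1}| ≤ ζ` if `m = 1`)
    have h1 : |Xr 3 (k - 1) t ^ 2 - W 2 (k - 1) t ^ 2| ≤
        2 * (K ^ 20)⁻¹ * (1 + ε₀) ^ (-(10 : ℝ) * ((m - 1 : ℕ) : ℝ)) := by
      have hidx : k - 1 = (m : ℤ) := by rw [hk]; ring
      rw [hidx]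
      rcases Nat.lt_or_ge m 2 with hm2 | hm2
      · obtain rfl : m = 1 := by omega
        have hd := hgt.d_le
        have hw := hζ t ht
        simp only [Nat.cast_one, Nat.sub_self, CharP.cast_eq_zero, mul_zero, Real.rpow_zero,
          mul_one]
        have h2 : Xr 3 1 t ^ 2 ≤ 1 / 4 * (K ^ 20)⁻¹ := by
          rw [← sq_abs]
          calc |Xr 3 1 t| ^ 2 ≤ (1 / 2 * (K ^ 10)⁻¹) ^ 2 := pow_le_pow_left₀ (abs_nonneg _) hd 2
            _ = 1 / 4 * (K ^ 20)⁻¹ := by rw [mul_pow, inv_pow, ← pow_mul]; norm_num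
        have h3 : W 2 1 t ^ 2 ≤ 1 / 4 * (K ^ 20)⁻¹ := by
          rw [← sq_abs]
          exact (pow_le_pow_left₀ (abs_nonneg _) hw 2).trans hζK
        have : 0 ≤ (K ^ 20)⁻¹ := by positivity
        rw [abs_le]
        constructor <;> nlinarith [sq_nonneg (Xr 3 1 t), sq_nonneg (W 2 1 t)]
      · have := hp3 (m - 1) (by omega)
        have hidx' : (1 : ℤ) + ((m - 1 : ℕ) : ℤ) = m := by
          rw [Nat.cast_sub (by omega)]; push_cast; ring
        rw [hidx'] at this
        have hK30 : (K ^ 30)⁻¹ ≤ (K ^ 20)⁻¹ :=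
          inv_anti₀ (by positivity) (pow_le_pow_right₀ hK1 (by norm_num))
        have hP : 0 ≤ (1 + ε₀) ^ (-(10 : ℝ) * ((m - 1 : ℕ) : ℝ)) := (Real.rpow_pos_of_pos hq0 _).le
        calc |Xr 3 (m : ℤ) t ^ 2 - W 2 (m : ℤ) t ^ 2|
            ≤ 2 * ((K ^ 30)⁻¹ * (1 + ε₀) ^ (-(10 : ℝ) * ((m - 1 : ℕ) : ℝ))) := this
          _ ≤ 2 * ((K ^ 20)⁻¹ * (1 + ε₀) ^ (-(10 : ℝ) * ((m - 1 : ℕ) : ℝ))) := by gcongr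
          _ = _ := by ring
    have hsqrt : ∀ {x : ℝ} {j : ℕ}, x ^ 2 ≤ 2 * ((K ^ 30)⁻¹ * (1 + ε₀) ^ (-(10 : ℝ) * j)) →
        |x| ≤ 2 * (K ^ 15)⁻¹ * (1 + ε₀) ^ (-(5 : ℝ) * j) := by
      intro x j hx
      apply abs_le_of_sq_le_sq _ (by positivity)
      refine hx.trans ?_
      have hsq : ((1 + ε₀) ^ (-(5 : ℝ) * j)) ^ 2 = (1 + ε₀) ^ (-(10 : ℝ) * j) := by
        rw [sq, ← Real.rpow_add hq0]; congr 1; ring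
      have hsq2 : (2 * (K ^ 15)⁻¹ * (1 + ε₀) ^ (-(5 : ℝ) * j)) ^ 2 =
          4 * ((K ^ 30)⁻¹ * (1 + ε₀) ^ (-(10 : ℝ) * j)) := by
        rw [mul_pow, mul_pow, hsq, inv_pow, ← pow_mul]; norm_num; ring
      rw [hsq2]
      have : 0 ≤ (K ^ 30)⁻¹ * (1 + ε₀) ^ (-(10 : ℝ) * j) := by positivity
      nlinarith
    have h2 : |Xr 0 k t| ≤ 2 * (K ^ 15)⁻¹ * (1 + ε₀) ^ (-(5 : ℝ) * m) := by
      have := hp0 m hm; rw [← hk] at this; exact hsqrt this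
    have h3 : |Xr 3 k t ^ 2 - W 2 k t ^ 2| ≤ 2 * ((K ^ 30)⁻¹ * (1 + ε₀) ^ (-(10 : ℝ) * m)) := by
      have := hp3 m hm; rwa [← hk] at this
    have h4 : |Xr 0 (k + 1) t| ≤ 2 * (K ^ 15)⁻¹ * (1 + ε₀) ^ (-(5 : ℝ) * ((m + 1 : ℕ) : ℝ)) := by
      have := hp0 (m + 1) (by omega)
      have hidx : (1 : ℤ) + ((m + 1 : ℕ) : ℤ) = k + 1 := by rw [hk]; push_cast; ring
      rw [hidx] at this; exact hsqrt this
    have hA := abs_splitFlux_le hε₀ hK h1 h2 h3 h4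
    refine hA.trans ?_
    have hm1R : ((m - 1 : ℕ) : ℝ) = m - 1 := by rw [Nat.cast_sub (by omega)]; push_cast; ring
    have hmp1R : ((m + 1 : ℕ) : ℝ) = m + 1 := by push_cast; ring
    -- exponent bookkeeping
    have e1 : (1 + ε₀) ^ ((5 : ℝ) * k / 2) * (1 + ε₀) ^ (-(10 : ℝ) * ((m - 1 : ℕ) : ℝ)) *
        (1 + ε₀) ^ (-(5 : ℝ) * m) ≤ (1 + ε₀) ^ ((13 : ℝ) + -(10 : ℝ) * m) :=
      rpow3_le_rpow hq1 (by rw [hkR, hm1R]; nlinarith)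
    have e2 : (1 + ε₀) ^ ((5 : ℝ) * k / 2) * (1 + ε₀) ^ ((5 : ℝ) / 2) *
        (1 + ε₀) ^ (-(10 : ℝ) * m) * (1 + ε₀) ^ (-(5 : ℝ) * ((m + 1 : ℕ) : ℝ)) ≤
        (1 + ε₀) ^ (-(10 : ℝ) * m) :=
      rpow4_le_rpow hq1 (by rw [hkR, hmp1R]; nlinarith)
    have h13 : (1 + ε₀) ^ ((13 : ℝ) + -(10 : ℝ) * m) ≤ 8192 * (1 + ε₀) ^ (-(10 : ℝ) * m) := by
      rw [Real.rpow_add hq0]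
      apply mul_le_mul_of_nonneg_right _ (Real.rpow_pos_of_pos hq0 _).le
      calc (1 + ε₀) ^ (13 : ℝ) ≤ (2 : ℝ) ^ (13 : ℝ) := Real.rpow_le_rpow hq0.le hq2 (by norm_num)
        _ = 8192 := by norm_num
    have hP : 0 < (1 + ε₀) ^ (-(10 : ℝ) * m) := Real.rpow_pos_of_pos hq0 _
    have hre : K * ((1 + ε₀) ^ ((5 : ℝ) * k / 2) *
        (2 * (K ^ 20)⁻¹ * (1 + ε₀) ^ (-(10 : ℝ) * ((m - 1 : ℕ) : ℝ)) *
          (2 * (K ^ 15)⁻¹ * (1 + ε₀) ^ (-(5 : ℝ) * m))) +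
        (1 + ε₀) ^ ((5 : ℝ) * k / 2) * (1 + ε₀) ^ ((5 : ℝ) / 2) *
          (2 * ((K ^ 30)⁻¹ * (1 + ε₀) ^ (-(10 : ℝ) * m)) *
            (2 * (K ^ 15)⁻¹ * (1 + ε₀) ^ (-(5 : ℝ) * ((m + 1 : ℕ) : ℝ))))) =
        4 * (K * ((K ^ 20)⁻¹ * (K ^ 15)⁻¹)) *
          ((1 + ε₀) ^ ((5 : ℝ) * k / 2) * (1 + ε₀) ^ (-(10 : ℝ) * ((m - 1 : ℕ) : ℝ)) *
            (1 + ε₀) ^ (-(5 : ℝ) * m)) +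
        4 * (K * ((K ^ 30)⁻¹ * (K ^ 15)⁻¹)) *
          ((1 + ε₀) ^ ((5 : ℝ) * k / 2) * (1 + ε₀) ^ ((5 : ℝ) / 2) *
            (1 + ε₀) ^ (-(10 : ℝ) * m) * (1 + ε₀) ^ (-(5 : ℝ) * ((m + 1 : ℕ) : ℝ))) := by ring
    rw [hre]
    have hK34 : K * ((K ^ 20)⁻¹ * (K ^ 15)⁻¹) = (K ^ 34)⁻¹ := by field_simp
    have hK44 : K * ((K ^ 30)⁻¹ * (K ^ 15)⁻¹) ≤ (K ^ 34)⁻¹ := by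
      rw [show K * ((K ^ 30)⁻¹ * (K ^ 15)⁻¹) = (K ^ 44)⁻¹ by field_simp]
      exact inv_anti₀ (by positivity) (pow_le_pow_right₀ hK1 (by norm_num))
    rw [hK34]
    have hK34p : 0 < (K ^ 34)⁻¹ := by positivity
    have hprod1 : 0 ≤ (1 + ε₀) ^ ((5 : ℝ) * k / 2) * (1 + ε₀) ^ ((5 : ℝ) / 2) *
        (1 + ε₀) ^ (-(10 : ℝ) * m) * (1 + ε₀) ^ (-(5 : ℝ) * ((m + 1 : ℕ) : ℝ)) := by positivity
    nlinarith [mul_le_mul_of_nonneg_right hK44 hprod1]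
  -- integrate and compare
  have hint := integral_le_hundred_mul hT (by positivity) hbound
  -- `q^{-499/50} ≤ q^{-1} = 1 - ε₀/(1+ε₀) ≤ 1 - ε₀/2`
  have hnum : (1 + ε₀) ^ (-(499 : ℝ) / 50) ≤ 1 - ε₀ / 2 := by
    calc (1 + ε₀) ^ (-(499 : ℝ) / 50) ≤ (1 + ε₀) ^ (-(1 : ℝ)) :=
          Real.rpow_le_rpow_of_exponent_le hq1 (by norm_num)
      _ = (1 + ε₀)⁻¹ := Real.rpow_neg_one _
      _ ≤ 1 - ε₀ / 2 := by
          rw [inv_le_iff_one_le_mul₀ hq0]; nlinarith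
  have hP : 0 < (1 + ε₀) ^ (-(10 : ℝ) * m) := Real.rpow_pos_of_pos hq0 _
  have hK30pos : 0 < (K ^ 30)⁻¹ := by positivity
  -- `3.3·10⁶ K^{-34} < (ε₀/2) K^{-30}` from `10⁸ ≤ ε₀ K⁴`
  have hkey : 3300000 * (K ^ 34)⁻¹ < ε₀ / 2 * (K ^ 30)⁻¹ := by
    have h34 : (K ^ 34)⁻¹ = (K ^ 4)⁻¹ * (K ^ 30)⁻¹ := by rw [← mul_inv, ← pow_add]
    have h4 : 3300000 * (K ^ 4)⁻¹ < ε₀ / 2 := by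
      rw [← div_eq_mul_inv, div_lt_iff₀ (by positivity)]
      nlinarith
    calc 3300000 * (K ^ 34)⁻¹ = (3300000 * (K ^ 4)⁻¹) * (K ^ 30)⁻¹ := by rw [h34]; ring
      _ < ε₀ / 2 * (K ^ 30)⁻¹ := mul_lt_mul_of_pos_right h4 hK30pos
  have hflux : Er k T ≤ Er k 0 + ∫ t in (0 : ℝ)..T, K * (1 + ε₀) ^ ((5 : ℝ) * k / 2) *
      ((Xr 3 (k - 1) t ^ 2 - W 2 (k - 1) t ^ 2) * Xr 0 k t -
        (1 + ε₀) ^ ((5 : ℝ) / 2) * (Xr 3 k t ^ 2 - W 2 k t ^ 2) * Xr 0 (k + 1) t) := hineq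
  have hEk0 : Er k 0 ≤ (1 - ε₀ / 2) * ((K ^ 30)⁻¹ * (1 + ε₀) ^ (-(10 : ℝ) * m)) := by
    rw [hk]
    exact hinit.trans (mul_le_mul_of_nonneg_right hnum (by positivity))
  have hstrict := mul_lt_mul_of_pos_right hkey hP
  linarith [hflux, hEk0, hint, hstrict]

/-! ## Corollary 6.11: the exit trichotomy -/

/-- **Corollary 6.11 (exit trichotomy).** Under the standing largeness (`10⁸ ≤ ε₀K⁴`, `ε ≤ 1`,
`n₀` large), at least one of: `Ẽ_{-1}(T₁) = K^{-10}(1+ε₀)^{2/10}` (backwards flow of energy),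
`|d_1(T₁)| = ½K^{-10}` (forwards flow of energy), `T₁ = 100` (running out the clock) — given the
checkpoint profile `η(0) ≤ 10⁻³` and the fresh shell's hand-off asymmetry `|Z̃_{d,1}| ≤ ζ`, `ζ² ≤ ¼K⁻²⁰` on
`[0, T₁]`. [cite: Tao2016AveragedNS, §6.5 Cor. 6.11] -/
theorem RescaledSplitHypotheses.exit_trichotomy
    (h : RescaledSplitHypotheses γ ε₀ K ε C₁ C₂ C₃ n₀ N ηp βp τ Xr W Er) (hε₀ : 0 < ε₀) (hε₀1 : ε₀ < 1)
    (hγ1 : γ ≤ 1 / 10 ^ 5) (hK : 0 < K) (hKε : 10 ^ 8 ≤ ε₀ * K ^ 4) (hε : 0 < ε) (hε1 : ε ≤ 1)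
    (hC₂ : 0 ≤ C₂) (hC₃ : 0 ≤ C₃) (hN : n₀ ≤ N)
    (hn : C₂ * (1 + ε₀) ^ (-(n₀ : ℝ) / 2) * cumEnergyConst ε₀ C₃ ≤ 1 / 100)
    (hη0 : ηp 0 ≤ 1 / 10 ^ 3) {ζ : ℝ} (hζ : ∀ t ∈ Icc 0 (T1 ε₀ K Xr Er), |W 2 1 t| ≤ ζ)
    (hζK : ζ ^ 2 ≤ 1 / 4 * (K ^ 20)⁻¹) :
    Er (-1) (T1 ε₀ K Xr Er) = (K ^ 10)⁻¹ * (1 + ε₀) ^ ((2 : ℝ) / 10) ∨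
      |Xr 3 1 (T1 ε₀ K Xr Er)| = 1 / 2 * (K ^ 10)⁻¹ ∨ T1 ε₀ K Xr Er = 100 := by
  have hK100 := hundred_le_of_regime hε₀1 hK hKε
  have hK2 : (2 : ℝ) ≤ K := by linarith
  have g0 := h.goodAt_zero hε₀ hε₀1 hγ1 hK2 hε hε1 hC₂ hC₃ hN hn hη0
  have hT := T1_mem g0
  have hgood : ∀ t ∈ Icc 0 (T1 ε₀ K Xr Er), GoodAt ε₀ K Xr Er t := fun t ht =>
    h.goodAt_of_mem_T1 hN g0 ht
  rcases T1_exit g0 with h100 | hnot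
  · exact Or.inr (Or.inr h100)
  · by_contra hcon
    push Not at hcon
    obtain ⟨hE, hd, -⟩ := hcon
    have gT := hgood _ ⟨hT.1, le_rfl⟩
    apply hnot
    apply h.eventually_goodAt_of_strict hε₀ hK hN hT
    · intro m hm
      rcases Nat.lt_or_ge m 3 with hm3 | hm3
      · obtain rfl : m = 2 := by omega
        have hle := gT.before 2 le_rfl
        have hidx : (1 : ℤ) - ((2 : ℕ) : ℤ) = -1 := by norm_num
        rw [hidx] at hle ⊢
        have hexp : (((2 : ℕ) : ℝ)) / 10 = (2 : ℝ) / 10 := by norm_num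
        rw [hexp] at hle ⊢
        exact lt_of_le_of_ne hle hE
      · exact h.exit_far hε₀ hε₀1 hK hKε hN hT hgood m hm3
    · exact h.exit_near hε₀ hε₀1 hγ1 hK hKε hε hε1 hC₂ hC₃ hN hn hη0 hT hgood hζ hζK
    · exact fun m hm => h.exit_far2 hε₀ hε₀1 hK hKε hN hT hgood hζ hζK m hm
    · exact lt_of_le_of_ne gT.d_le hd

end Exit

end Tao2016AveragedNS

end Literature.Analysis.FluidPDE
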